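import Literature.Algebra.Polynomial.BinomialTypeSequences
import Literature.Algebra.Polynomial.UmbralInversePairs
import Mathlib.Tactic
import HarnessLib

/-!
# Inverse relations from connection constants (Rota–Kahaner–Odlyzko §13)

G.-C. Rota, D. Kahaner, A. Odlyzko, *Finite operator calculus* (1973), §13 "Inverse Relations",
pp. 738–739:

> Given two polynomial sequences `p_n (x)` and `q_n (x)`, suppose we can determine the connection
> constants `p_n (x) = Σ_{k=0}^{n} c_{nk} q_k (x)`, `q_n (x) = Σ_{k=0}^{n} d_{nk} p_k (x)`, then we can
> derive a pair of inverse relations. Given any sequence `a_n`, set `L (q_n (x)) = a_n`; this defines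
> a linear functional `L` on the space `P`. If `b_n = L (p_n (x))`, we have
> `b_n = Σ_{k=0}^{n} c_{nk} a_k`,  (*)  `a_n = Σ_{k=0}^{n} d_{nk} b_k`.
> By specializing to suitable sets of Sheffer polynomials, a great many of the inverse relations in
> the literature can be explained. In this context, Theorem 7 will help find the inverse of certain
> infinite matrices. The simple inverse relations in Riordan (pp. 43–49) fall under the present
> scheme … the rest result from an umbral interpretation of the foregoing identities for Laguerre
> polynomials. For example, 6 follows from the fact that the basic Laguerre polynomials are
> self-inverse. For the sake of clarity we discuss the simplest of all inverse relations, namely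
> `a_n = Σ_k (−1)^k C(n,k) b_k`; `b_n = Σ_k (−1)^k C(n,k) a_k`.  (*)
> This is immediately understood by defining the linear functional `L (xⁿ) = b_n`, which by the
> first identity gives `a_n = L ((1 − x)ⁿ)`. Hence, `b_n = L ((1 − (1 − x))ⁿ)`, which is the second
> identity.

What is typed (everything proved):
* the functional `L` of the scheme (`seqFunctional hq a`, `L (q_n) = a_n`, unique) and the scheme
  itself — `seqFunctional_apply_eq_sum` (`b_n = L (p_n) = Σ c_{nk} a_k`),
  `eq_sum_mul_seqFunctional_apply` (`a_n = Σ d_{nk} L (p_k)`), `inverseRelation` (on the scalar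
  sequences), `inverseRelation_iff`, and the matrix reading `Σ_k d_{nk} c_{kj} = δ_{nj}`
  (`sum_connection_mul_connection`); "we can determine the connection constants": they are the
  coordinates in the basis `(q_n)` (`eq_sum_seqBasis_repr_smul`, `seqBasis_repr_eq_of_eq_sum`);
* the simplest inverse relation with the printed two-line proof, over any commutative ring
  (`binomialInverseRelation`, `binomialInverseRelation_iff`);
* two of the "great many" instances, read off from inverse pairs already in the tree: the Laguerre
  (Lah-matrix) relation from `L_n (L (x)) = xⁿ` (`laguerreInverseRelation_iff`) and the Stirling
  relation from the inverse pair `(x)_n`, `φ_n` (`stirlingInverseRelation_iff`).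

Dictionary: `seqBasis hq` is the basis `(q_n)` of `K[X]` (`BinomialTypeSequences`); `umbralComp`,
`laguerreBasic`, `touchardPolynomial K n = φ_n = Σ_k S(n,k) xᵏ`, `descPochhammer K n = (x)_n = Σ_k s(n,k) xᵏ`
as in `UmbralInversePairs`. Nearest existing declarations (disclosed, not restated): the orthogonality
relations `sum_coeff_descPochhammer_mul_stirlingSecond` / `sum_stirlingSecond_mul_coeff_descPochhammer` and
`sum_coeff_laguerreBasic_smul_laguerreBasic` (`UmbralInversePairs`), which are the matrix identities behind
the two instances; `Literature.Combinatorics.Enumerative.OGFEulerTransform.seqEulerTransform`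
(`Σ_k (−1)^k C(n,k) a_k` as a transform of sequences — its involutivity is `binomialInverseRelation`; that
module is not imported here); Mathlib's `Int.alternating_sum_range_choose`.

## References
* [RotaKahanerOdlyzko1973] G.-C. Rota, D. Kahaner, A. Odlyzko, *On the foundations of
  combinatorial theory VIII. Finite operator calculus*, J. Math. Anal. Appl. 42 (1973) 684–760,
  §13 "Inverse Relations", pp. 738–739; §11 p. 729 and §14 pp. 747–749 for the two instances.
-/

noncomputable section

open Polynomial Finset

namespace Literature.Algebra.Polynomial

/-! ## The simplest inverse relation: `a_n = Σ (−1)^k C(n,k) b_k ⟺ b_n = Σ (−1)^k C(n,k) a_k` -/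

section Binomial

variable {R : Type*} [CommRing R]

/-- `(1 − y)ⁿ = Σ_{k ≤ n} (−1)^k C(n,k) yᵏ` in `R[X]` (the "first identity" read as an expansion).
[cite: RotaKahanerOdlyzko1973, §13, p. 739] -/
theorem one_sub_pow_eq_sum_smul (f : R[X]) (n : ℕ) :
    (1 - f) ^ n = ∑ k ∈ range (n + 1), ((-1) ^ k * (n.choose k : R)) • f ^ k := by
  rw [sub_eq_neg_add, add_pow]
  refine sum_congr rfl fun k _ => ?_
  rw [one_pow, mul_one, neg_pow, smul_eq_C_mul, map_mul, map_pow, map_neg, map_one, map_natCast]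
  ring

/-- **The simplest of all inverse relations** — `a_n = Σ_k (−1)^k C(n,k) b_k` implies
`b_n = Σ_k (−1)^k C(n,k) a_k` — with the printed proof: the linear functional `L (xⁿ) = b_n` has
`a_n = L ((1 − x)ⁿ)` by the first identity, hence `b_n = L ((1 − (1 − x))ⁿ)` is the second.
[cite: RotaKahanerOdlyzko1973, §13 (*), pp. 738–739] -/
theorem binomialInverseRelation {a b : ℕ → R}
    (h : ∀ n, a n = ∑ k ∈ range (n + 1), (-1) ^ k * (n.choose k : R) * b k) (n : ℕ) :
    b n = ∑ k ∈ range (n + 1), (-1) ^ k * (n.choose k : R) * a k := by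
  -- the linear functional `L (xⁿ) = b_n`
  let L : R[X] →ₗ[R] R := Polynomial.lsum fun k => (LinearMap.id : R →ₗ[R] R).smulRight (b k)
  have hLX : ∀ k, L (X ^ k) = b k := fun k => by
    change Polynomial.lsum _ (X ^ k) = b k
    rw [Polynomial.lsum_apply, X_pow_eq_monomial, sum_monomial_index _ _ (by simp)]
    simp
  -- "which by the first identity gives `a_n = L ((1 − x)ⁿ)`"
  have hLa : ∀ m, L ((1 - X) ^ m) = a m := fun m => by
    rw [one_sub_pow_eq_sum_smul, map_sum, h m]
    exact sum_congr rfl fun k _ => by rw [map_smul, hLX, smul_eq_mul]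
  -- "Hence `b_n = L ((1 − (1 − x))ⁿ)`, which is the second identity."
  calc b n = L ((1 - (1 - X)) ^ n) := by rw [sub_sub_cancel, hLX]
    _ = ∑ k ∈ range (n + 1), (-1) ^ k * (n.choose k : R) * a k := by
        rw [one_sub_pow_eq_sum_smul, map_sum]
        exact sum_congr rfl fun k _ => by rw [map_smul, hLa, smul_eq_mul]

/-- The two identities (*) are equivalent (the relation is an involution).
[cite: RotaKahanerOdlyzko1973, §13 (*), pp. 738–739] -/
theorem binomialInverseRelation_iff (a b : ℕ → R) :
    (∀ n, a n = ∑ k ∈ range (n + 1), (-1) ^ k * (n.choose k : R) * b k) ↔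
      ∀ n, b n = ∑ k ∈ range (n + 1), (-1) ^ k * (n.choose k : R) * a k :=
  ⟨fun h => binomialInverseRelation h, fun h => binomialInverseRelation h⟩

end Binomial

variable {K : Type*} [Field K]

/-! ## "We can determine the connection constants": coordinates in the basis `(q_n)` -/

section Coordinates

variable {q : ℕ → K[X]} (hq : ∀ n : ℕ, (q n).degree = n)
include hq

/-- The coordinates of `f` in the basis `(q_n)` vanish above `deg f` (the `q_k`, `k ≤ m`, span the
polynomials of degree `≤ m`). [cite: RotaKahanerOdlyzko1973, §13 (connection constants
`p_n = Σ_{k=0}^{n} c_{nk} q_k`), p. 738] -/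
theorem seqBasis_repr_eq_zero_of_natDegree_lt {f : K[X]} {k : ℕ} (hk : f.natDegree < k) :
    (seqBasis hq).repr f k = 0 := by
  have hS := Polynomial.Sequence.span_degreeLE (⟨q, hq⟩ : Polynomial.Sequence K) (m := f.natDegree)
    fun i _ => isUnit_iff_ne_zero.2 (leadingCoeff_ne_zero.2
      (Polynomial.Sequence.ne_zero (⟨q, hq⟩ : Polynomial.Sequence K) i))
  have himg : (seqBasis hq) '' Set.Iic f.natDegree =
      (⟨q, hq⟩ : Polynomial.Sequence K) '' Set.Iic f.natDegree :=
    Set.image_congr' fun k => seqBasis_apply hq k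
  have hmem : f ∈ Submodule.span K ((seqBasis hq) '' Set.Iic f.natDegree) := by
    rw [himg, hS, Polynomial.mem_degreeLE]
    exact degree_le_natDegree
  have hsub := (seqBasis hq).repr_support_subset_of_mem_span _ hmem
  by_contra h
  exact absurd (Set.mem_Iic.1 (hsub (Finsupp.mem_support_iff.2 h))) (not_le.2 hk)

/-- **`f = Σ_{k < N} [f]_k q_k`** for any `N > deg f`, `[f]_k` the coordinates in the basis `(q_n)`:
the connection constants of any polynomial (sequence) with the `q_k` exist.
[cite: RotaKahanerOdlyzko1973, §13, p. 738] -/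
theorem eq_sum_seqBasis_repr_smul (f : K[X]) {N : ℕ} (hN : f.natDegree < N) :
    f = ∑ k ∈ range N, (seqBasis hq).repr f k • q k := by
  have hsub : ((seqBasis hq).repr f).support ⊆ range N := by
    intro k hk
    by_contra hkN
    exact (Finsupp.mem_support_iff.1 hk)
      (seqBasis_repr_eq_zero_of_natDegree_lt hq (lt_of_lt_of_le hN (not_lt.1 (mem_range.not.1 hkN))))
  conv_lhs => rw [← (seqBasis hq).linearCombination_repr f]
  rw [Finsupp.linearCombination_apply, Finsupp.sum_of_support_subset ((seqBasis hq).repr f) hsub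
    (fun i a => a • (seqBasis hq) i) (fun k _ => zero_smul K _)]
  exact sum_congr rfl fun k _ => by rw [seqBasis_apply]

/-- … and they are unique: if `f = Σ_{k < N} c_k q_k` then `c_k = [f]_k` (`k < N`).
[cite: RotaKahanerOdlyzko1973, §13, p. 738] -/
theorem seqBasis_repr_eq_of_eq_sum {f : K[X]} {N : ℕ} {c : ℕ → K}
    (h : f = ∑ k ∈ range N, c k • q k) {k : ℕ} (hk : k < N) : (seqBasis hq).repr f k = c k := by
  rw [h, map_sum, Finsupp.finsetSum_apply]
  have hterm : ∀ j ∈ range N, ((seqBasis hq).repr (c j • q j)) k = if k = j then c k else 0 :=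
    fun j _ => by
      rw [map_smul, ← seqBasis_apply hq j, (seqBasis hq).repr_self, Finsupp.smul_apply,
        Finsupp.single_apply, smul_eq_mul]
      by_cases hjk : k = j
      · subst hjk; rw [if_pos rfl, if_pos rfl, mul_one]
      · rw [if_neg (Ne.symm hjk), if_neg hjk, mul_zero]
  rw [sum_congr rfl hterm, sum_ite_eq, if_pos (mem_range.2 hk)]

/-- In particular a polynomial sequence `(p_n)` has connection constants
`p_n = Σ_{k=0}^{n} c_{nk} q_k` with `c_{nk} = [p_n]_k`. [cite: RotaKahanerOdlyzko1973, §13, p. 738] -/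
theorem eq_sum_seqBasis_repr_smul_of_degree_eq {p : ℕ → K[X]} (hp : ∀ n : ℕ, (p n).degree = n) (n : ℕ) :
    p n = ∑ k ∈ range (n + 1), (seqBasis hq).repr (p n) k • q k :=
  eq_sum_seqBasis_repr_smul hq (p n) (by rw [natDegree_eq_of_degree_eq_some (hp n)]; exact lt_add_one n)

end Coordinates

/-! ## The functional `L (q_n) = a_n` and the inverse relations (*) -/

section Scheme

variable {q : ℕ → K[X]} (hq : ∀ n : ℕ, (q n).degree = n)

/-- **The linear functional of the scheme**: "Given any sequence `a_n`, set `L (q_n (x)) = a_n`; this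
defines a linear functional `L` on the space `P`." [cite: RotaKahanerOdlyzko1973, §13, p. 738] -/
def seqFunctional (a : ℕ → K) : K[X] →ₗ[K] K :=
  (seqBasis hq).constr K a

include hq

/-- `L (q_n) = a_n`. [cite: RotaKahanerOdlyzko1973, §13, p. 738] -/
theorem seqFunctional_apply_self (a : ℕ → K) (n : ℕ) : seqFunctional hq a (q n) = a n := by
  have h := (seqBasis hq).constr_basis K a n
  rwa [seqBasis_apply] at h

/-- "this defines a linear functional": `L` is the unique functional with `L (q_n) = a_n`.
[cite: RotaKahanerOdlyzko1973, §13, p. 738] -/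
theorem eq_seqFunctional_of_apply_eq {a : ℕ → K} {L : K[X] →ₗ[K] K} (h : ∀ n, L (q n) = a n) :
    L = seqFunctional hq a :=
  linearMap_ext_of_degree_eq hq fun n => by rw [h, seqFunctional_apply_self]

/-- `L (Σ_k c_k q_k) = Σ_k c_k a_k`. [cite: RotaKahanerOdlyzko1973, §13, p. 738] -/
theorem seqFunctional_apply_sum_smul (a : ℕ → K) (s : Finset ℕ) (c : ℕ → K) :
    seqFunctional hq a (∑ k ∈ s, c k • q k) = ∑ k ∈ s, c k * a k := by
  rw [map_sum]
  exact sum_congr rfl fun k _ => by rw [map_smul, seqFunctional_apply_self, smul_eq_mul]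

omit hq in
/-- On the monomial basis `q_n = xⁿ`, `L (f) = Σ_k [xᵏ] f · a_k` (the umbral functional `xᵏ ↦ a_k`).
[cite: RotaKahanerOdlyzko1973, §13 ("defining the linear functional `L (xⁿ) = b_n`"), p. 739] -/
theorem seqFunctional_X_pow_apply (a : ℕ → K) (f : K[X]) {N : ℕ} (hN : f.natDegree < N) :
    seqFunctional (fun n => degree_X_pow n) a f = ∑ k ∈ range N, f.coeff k * a k := by
  conv_lhs => rw [f.as_sum_range_C_mul_X_pow' hN]
  rw [map_sum]
  exact sum_congr rfl fun k _ => by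
    rw [← smul_eq_C_mul, map_smul, seqFunctional_apply_self, smul_eq_mul]

variable {p : ℕ → K[X]} {c d : ℕ → ℕ → K} {s t : ℕ → Finset ℕ}

/-- **First half of (*)**: if `p_n = Σ_k c_{nk} q_k` then `b_n := L (p_n) = Σ_k c_{nk} a_k`.
[cite: RotaKahanerOdlyzko1973, §13 (*), p. 738] -/
theorem seqFunctional_apply_eq_sum (hpq : ∀ n, p n = ∑ k ∈ s n, c n k • q k) (a : ℕ → K) (n : ℕ) :
    seqFunctional hq a (p n) = ∑ k ∈ s n, c n k * a k := by
  rw [hpq n, seqFunctional_apply_sum_smul]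

/-- **Second half of (*)**: if `q_n = Σ_k d_{nk} p_k` then `a_n = Σ_k d_{nk} b_k` with `b_k = L (p_k)`.
[cite: RotaKahanerOdlyzko1973, §13 (*), p. 738] -/
theorem eq_sum_mul_seqFunctional_apply (hqp : ∀ n, q n = ∑ k ∈ t n, d n k • p k) (a : ℕ → K)
    (n : ℕ) : a n = ∑ k ∈ t n, d n k * seqFunctional hq a (p k) := by
  conv_lhs => rw [← seqFunctional_apply_self hq a n, hqp n]
  rw [map_sum]
  exact sum_congr rfl fun k _ => by rw [map_smul, smul_eq_mul]

/-- **The pair of inverse relations derived from the connection constants**: with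
`p_n = Σ_k c_{nk} q_k` and `q_n = Σ_k d_{nk} p_k` (`(q_n)` a polynomial sequence), for ANY sequence
`a_n` the sequence `b_n = Σ_k c_{nk} a_k` satisfies `a_n = Σ_k d_{nk} b_k`.
[cite: RotaKahanerOdlyzko1973, §13 (*), p. 738] -/
theorem inverseRelation (hpq : ∀ n, p n = ∑ k ∈ s n, c n k • q k)
    (hqp : ∀ n, q n = ∑ k ∈ t n, d n k • p k) {a b : ℕ → K} (hb : ∀ n, b n = ∑ k ∈ s n, c n k * a k)
    (n : ℕ) : a n = ∑ k ∈ t n, d n k * b k := by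
  rw [eq_sum_mul_seqFunctional_apply hq hqp a n]
  exact sum_congr rfl fun k _ => by rw [seqFunctional_apply_eq_sum hq hpq, hb]

omit hq in
/-- Both directions, when `(p_n)` and `(q_n)` are both polynomial sequences:
`(∀ n, b_n = Σ_k c_{nk} a_k) ⟺ (∀ n, a_n = Σ_k d_{nk} b_k)`. [cite: RotaKahanerOdlyzko1973, §13 (*), p. 738] -/
theorem inverseRelation_iff (hp : ∀ n : ℕ, (p n).degree = n) (hq : ∀ n : ℕ, (q n).degree = n)
    (hpq : ∀ n, p n = ∑ k ∈ s n, c n k • q k) (hqp : ∀ n, q n = ∑ k ∈ t n, d n k • p k) (a b : ℕ → K) :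
    (∀ n, b n = ∑ k ∈ s n, c n k * a k) ↔ ∀ n, a n = ∑ k ∈ t n, d n k * b k :=
  ⟨fun hb => inverseRelation hq hpq hqp hb, fun ha => inverseRelation hp hqp hpq ha⟩

/-- **The matrix reading** ("Theorem 7 will help find the inverse of certain infinite matrices"): the
lower-triangular matrices `(c_{nk})`, `(d_{nk})` of connection constants are inverse to each other,
`Σ_{k=j}^{n} d_{nk} c_{kj} = δ_{nj}`. [cite: RotaKahanerOdlyzko1973, §13, p. 738] -/
theorem sum_connection_mul_connection (hpq : ∀ n, p n = ∑ k ∈ range (n + 1), c n k • q k)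
    (hqp : ∀ n, q n = ∑ k ∈ range (n + 1), d n k • p k) (n j : ℕ) :
    ∑ k ∈ Icc j n, d n k * c k j = if j = n then 1 else 0 := by
  have hb : ∀ k, (if j ≤ k then c k j else 0) =
      ∑ i ∈ range (k + 1), c k i * (if i = j then (1 : K) else 0) := fun k => by
    simp_rw [mul_ite, mul_one, mul_zero]
    simp only [sum_ite_eq', mem_range, Nat.lt_succ_iff]
  have h := inverseRelation hq hpq hqp (a := fun i => if i = j then (1 : K) else 0)
    (b := fun k => if j ≤ k then c k j else 0) hb n
  rw [eq_comm, show (if j = n then (1 : K) else 0) = if n = j then 1 else 0 by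
    by_cases hnj : n = j <;> simp [hnj, eq_comm], h]
  simp_rw [mul_ite, mul_zero]
  rw [← sum_filter]
  refine sum_congr ?_ fun k _ => rfl
  ext k
  simp only [mem_filter, mem_range, mem_Icc]
  omega

end Scheme

/-! ## Two instances: the Laguerre (Lah) relation and the Stirling relation -/

section Instances

variable (K)

/-- A polynomial is the sum of its monomials: `f = Σ_{k < N} [xᵏ] f · xᵏ` (`N > deg f`).
[cite: RotaKahanerOdlyzko1973, §13, p. 738] -/
theorem eq_sum_coeff_smul_X_pow {f : K[X]} {N : ℕ} (hN : f.natDegree < N) :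
    f = ∑ k ∈ range N, f.coeff k • (X : K[X]) ^ k := by
  conv_lhs => rw [f.as_sum_range_C_mul_X_pow' hN]
  exact sum_congr rfl fun k _ => by rw [smul_eq_C_mul]

variable [CharZero K]

/-- **The inverse relation of the self-inverse basic Laguerre set** ("6 follows from the fact that the
basic Laguerre polynomials are self-inverse"): with `L_n (x) = Σ_k l(n,k) xᵏ`,
`(∀ n, b_n = Σ_k l(n,k) a_k) ⟺ (∀ n, a_n = Σ_k l(n,k) b_k)`.
[cite: RotaKahanerOdlyzko1973, §13, p. 738] [cite: RotaKahanerOdlyzko1973, §11 (`L_n (L (x)) = xⁿ`), p. 729] -/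
theorem laguerreInverseRelation_iff (a b : ℕ → K) :
    (∀ n, b n = ∑ k ∈ range (n + 1), (laguerreBasic K n).coeff k * a k) ↔
      ∀ n, a n = ∑ k ∈ range (n + 1), (laguerreBasic K n).coeff k * b k := by
  have hLX : ∀ n, laguerreBasic K n =
      ∑ k ∈ range (n + 1), (laguerreBasic K n).coeff k • (X : K[X]) ^ k := fun n =>
    eq_sum_coeff_smul_X_pow K (by rw [natDegree_laguerreBasic]; exact lt_add_one n)
  have hXL : ∀ n, (X : K[X]) ^ n =
      ∑ k ∈ range (n + 1), (laguerreBasic K n).coeff k • laguerreBasic K k := fun n =>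
    (sum_coeff_laguerreBasic_smul_laguerreBasic K n).symm
  exact inverseRelation_iff ((isBasicSequence_laguerreBasic K).degree_eq) (fun n => degree_X_pow n)
    hLX hXL a b

/-- **The Stirling inverse relation** from the inverse pair `(x)_n`, `φ_n` (`φ_n = Σ_k S(n,k) xᵏ`,
`xⁿ = Σ_k s(n,k) φ_k`, `s(n,k) = [xᵏ] (x)_n` the signed Stirling numbers of the first kind):
`(∀ n, b_n = Σ_k S(n,k) a_k) ⟺ (∀ n, a_n = Σ_k s(n,k) b_k)`.
[cite: RotaKahanerOdlyzko1973, §13, p. 738] [cite: RotaKahanerOdlyzko1973, §14 ("the connection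
constants … are the Stirling numbers"), p. 748] -/
theorem stirlingInverseRelation_iff (a b : ℕ → K) :
    (∀ n, b n = ∑ k ∈ range (n + 1), (n.stirlingSecond k : K) * a k) ↔
      ∀ n, a n = ∑ k ∈ range (n + 1), (descPochhammer K n).coeff k * b k := by
  have hφX : ∀ n, touchardPolynomial K n =
      ∑ k ∈ range (n + 1), (n.stirlingSecond k : K) • (X : K[X]) ^ k := fun n => by
    conv_lhs => rw [eq_sum_coeff_smul_X_pow K
      (show (touchardPolynomial K n).natDegree < n + 1 by
        rw [natDegree_touchardPolynomial]; exact lt_add_one n)]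
    exact sum_congr rfl fun k _ => by rw [coeff_touchardPolynomial]
  have hXφ : ∀ n, (X : K[X]) ^ n =
      ∑ k ∈ range (n + 1), (descPochhammer K n).coeff k • touchardPolynomial K k := fun n =>
    (sum_coeff_descPochhammer_smul_touchardPolynomial K n).symm
  exact inverseRelation_iff (isBasicSequence_touchardPolynomial K).degree_eq (fun n => degree_X_pow n)
    hφX hXφ a b

end Instances

end Literature.Algebra.Polynomial
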